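/-
COR-CM (cell pub-hodgecm2) — Δ2 BRIDGE, item (c) J-RECORD PIN: the J2 pin `ComponentAlbanese` value AS A TERM with its LEVEL LAW
`(J.Γof K).K = K` (the `hΓ` binder of prove-3's (d) composition `nonempty_hcmPieces_atJRecordPin ∕ _atUniformRest`, which a bare
`Nonempty` loses under `Classical.choice`).  Seat prover-pub-hodgecm2-d2bridge-prove-5-g0-0; explicit per-declaration binders.
FRAMING: HC_CM is NOT proved; «Δ2 BRIDGE CLOSED» is NOT claimed.
-/
import Summits.HodgeConjecture.CorCM.D2Bridge.ComponentAlbanesePin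
import HarnessLib

/-!
# Δ2 bridge, J-record pin: the `ComponentAlbanese` term and its level law

* DEF `componentAlbanesePin` — the witness of `nonempty_componentAlbanesePin` as a term (`Γof := levelOf V`,
  `alb K h := albOnPiece ((sec42DataOfFourLe …).alb K) (componentInj … K h) (basePt … K h)`), `componentAlbanesePin_Γof` (`rfl`).
* DEF `componentAlbanesePinTotal` — its transport to the TOTAL carrier `Model.sec42DataOf ∕ sec42DataOf_heckeTranslates`.
* `componentAlbanesePin_levelLaw ∕ componentAlbanesePinTotal_levelLaw` — `((J.Γof K₁).K : Subgroup _) = K₁.1` (prove-3's `hΓ`, token for token),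
  and the `∃ J, levelLaw J` forms `exists_componentAlbanesePin_levelLaw ∕ exists_componentAlbanesePinTotal_levelLaw`.

HC_CM is NOT proved; nothing here is a display or a pointer move.
-/

set_option autoImplicit false

noncomputable section

open Function CategoryTheory CategoryTheory.Limits AlgebraicGeometry NumberField
open Literature.AlgebraicGeometry.Motives
open Literature.AlgebraicGeometry.HodgeTheory
open Literature.AlgebraicGeometry.ShimuraVarieties
open Literature.AlgebraicGeometry.ShimuraVarieties.UnitaryCanonicalModel
open Literature.NumberTheory.Automorphic Literature.NumberTheory.Automorphic.PicardCM
open Literature.NumberTheory.Automorphic.Liu2021 Literature.NumberTheory.Automorphic.Liu2021.AppendixC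
open Literature.NumberTheory.Transcendental (Arapura2012_Cor_15_4_6)
open Summit.HodgeConjecture.CorCM.Model Summit.HodgeConjecture.CorCM.HComp
open HodgeCM.Model HodgeCM.Model.LevelTranslate HodgeCM.Model.TowerLevel

namespace Summit.HodgeConjecture.CorCM.D2Bridge

open AbelianVariety (bcFunctor)

variable {L : HodgeCM.CMField} {ι₁ : L →+* ℂ}

/-- **The J2 interface value AS A TERM** at Liu's explicit §4.2 carrier `Model.sec42DataOfFourLe` and its Hecke translates — the
witness of `nonempty_componentAlbanesePin`: `Γof := levelOf V`, `alb K h := albOnPiece (C.alb K) (componentInj K h) (basePt K h)`,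
laws (ii)–(iv), (v′) from `ComponentAlbanesePin.lean`. [cite: Liu2021, proof of Lemma 2.4 (1) (FJcycle.tex l. 1220–1228); §4.2 l. 2062–2074] [cite: Deligne1979ShimuraVarieties, §2.1.2] -/
def componentAlbanesePin (hHD : exists_isReal_hodgeModel) (hI : hodgePQ_independent_of_hodgeModel)
    (hU : BallQuotientUniformisedDatum) (h₃ : CMAbelianVarietyRealised) (hA : Arapura2012_Cor_15_4_6)
    (hU7 : heckeTranslate_definedOver) (V : HodgeCM.HermSpace3 L ι₁) (h : exists_recordSystem) (h4 : 4 ≤ Module.finrank ℚ L)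
    [Algebra L ℂ] (hι : (algebraMap L ℂ).comp (cmConjRingHom L) = ι₁) (Φ : CMType (pkgF L)) (iso : ℕ → Prop) :
    ComponentAlbanese hHD hI hU h₃ hA V h Φ (sec42DataOfFourLe h (pkgV V) Φ h4 iso)
      (sec42DataOfFourLe_heckeTranslates hU7 h (pkgV V) Φ h4 iso) where
  Γof := levelOf V
  belowConjThree := belowConjThree_levelOf V
  Γof_mono := fun hle => levelOf_mono V hle
  Γof_hecke := fun _ _ _ hle => levelOf_le_conj_of_heckeLE V hle
  alb := fun K hh =>
    haveI := geometricallyIrreducible_pms hU h₃ (code V K hh)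
    albOnPiece ((sec42DataOfFourLe h (pkgV V) Φ h4 iso).alb K) (componentInj V hU h₃ h4 h hHD hι K hh) (basePt V hU h₃ K hh)
  pull_alb_rel := fun K _ _ _ r => by
    rw [HodgeCM.Model.universeOf_pull]
    exact pull_albOnPiece_componentInj_rel V hU h₃ h4 h hHD hι hA Φ iso K r 1
  pull_alb_Atr := fun f hh => by
    rw [HodgeCM.Model.universeOf_pull]
    exact pull_albOnPiece_componentInj_Atr V hU h₃ h4 h hHD hι hA Φ iso f hh 1
  pull_alb_albTr := fun g _ _ hK hh => by
    rw [HodgeCM.Model.universeOf_pull]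
    exact pull_albOnPiece_componentInj_albTr V hU h₃ h4 h hHD hι hA hU7 Φ iso g hK hh 1
  alb_detect := fun K _ φ hφ => exists_pull_albOnPiece_componentInj_ne_zero V hU h₃ h4 h hHD hι Φ iso K φ hφ

/-- Its level dictionary is `levelOf V` (by `rfl`). [cite: Liu2021, Prop. C.5 l. 4627–4628] -/
@[simp] theorem componentAlbanesePin_Γof (hHD : exists_isReal_hodgeModel) (hI : hodgePQ_independent_of_hodgeModel)
    (hU : BallQuotientUniformisedDatum) (h₃ : CMAbelianVarietyRealised) (hA : Arapura2012_Cor_15_4_6)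
    (hU7 : heckeTranslate_definedOver) (V : HodgeCM.HermSpace3 L ι₁) (h : exists_recordSystem) (h4 : 4 ≤ Module.finrank ℚ L)
    [Algebra L ℂ] (hι : (algebraMap L ℂ).comp (cmConjRingHom L) = ι₁) (Φ : CMType (pkgF L)) (iso : ℕ → Prop)
    (K₁ : C5.SmallLevel (K3 (pkgV V))) :
    (componentAlbanesePin hHD hI hU h₃ hA hU7 V h h4 hι Φ iso).Γof K₁ = levelOf V K₁ := rfl

/-- **The level law `hΓ` at the explicit carrier**: `(J.Γof K₁).K = K₁` (prove-3's binder, token for token). [cite: Liu2021, Prop. C.5 l. 4627–4628] -/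
theorem componentAlbanesePin_levelLaw (hHD : exists_isReal_hodgeModel) (hI : hodgePQ_independent_of_hodgeModel)
    (hU : BallQuotientUniformisedDatum) (h₃ : CMAbelianVarietyRealised) (hA : Arapura2012_Cor_15_4_6)
    (hU7 : heckeTranslate_definedOver) (V : HodgeCM.HermSpace3 L ι₁) (h : exists_recordSystem) (h4 : 4 ≤ Module.finrank ℚ L)
    [Algebra L ℂ] (hι : (algebraMap L ℂ).comp (cmConjRingHom L) = ι₁) (Φ : CMType (pkgF L)) (iso : ℕ → Prop)
    (K₁ : C5.SmallLevel (sec42DataOfFourLe h (pkgV V) Φ h4 iso).S.K₀) :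
    (((componentAlbanesePin hHD hI hU h₃ hA hU7 V h h4 hι Φ iso).Γof K₁).K : Subgroup ↥V.adelicFin) =
      (K₁.1 : Subgroup (sec42DataOfFourLe h (pkgV V) Φ h4 iso).G) := rfl

/-- **The J2 interface value AS A TERM at the TOTAL carrier** `Model.sec42DataOf h iso …` ∕ `Model.sec42DataOf_heckeTranslates`
(`ComponentAlbanese.transport` along `Model.sec42DataOf_eq_of_four_le`). [cite: Liu2021, §4.2 l. 2053–2074] -/
def componentAlbanesePinTotal (hHD : exists_isReal_hodgeModel) (hI : hodgePQ_independent_of_hodgeModel)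
    (hU : BallQuotientUniformisedDatum) (h₃ : CMAbelianVarietyRealised) (hA : Arapura2012_Cor_15_4_6)
    (hU7 : heckeTranslate_definedOver) (V : HodgeCM.HermSpace3 L ι₁) (h : exists_recordSystem) (h4 : 4 ≤ Module.finrank ℚ L)
    [Algebra L ℂ] (hι : (algebraMap L ℂ).comp (cmConjRingHom L) = ι₁) (Φ : CMType (pkgF L))
    (iso : ∀ (F : Summit.HodgeConjecture.CorCM.CMField) (ι : F →+* ℂ) (_ : Summit.HodgeConjecture.CorCM.HermSpace3 F ι)
      (_ : CMType F), ℕ → Prop) :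
    ComponentAlbanese hHD hI hU h₃ hA V h Φ (sec42DataOf h iso (pkgF L) ι₁ (pkgV V) Φ)
      (sec42DataOf_heckeTranslates hU7 h (pkgV V) Φ iso h4) :=
  (componentAlbanesePin hHD hI hU h₃ hA hU7 V h h4 hι Φ (iso (pkgF L) ι₁ (pkgV V) Φ)).transport
    (sec42DataOf_eq_of_four_le h (pkgV V) Φ iso h4).symm

/-- **The level law `hΓ` at the TOTAL carrier**: `(J.Γof K₁).K = K₁` for `J := componentAlbanesePinTotal …`. [cite: Liu2021, Prop. C.5 l. 4627–4628] -/
theorem componentAlbanesePinTotal_levelLaw (hHD : exists_isReal_hodgeModel) (hI : hodgePQ_independent_of_hodgeModel)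
    (hU : BallQuotientUniformisedDatum) (h₃ : CMAbelianVarietyRealised) (hA : Arapura2012_Cor_15_4_6)
    (hU7 : heckeTranslate_definedOver) (V : HodgeCM.HermSpace3 L ι₁) (h : exists_recordSystem) (h4 : 4 ≤ Module.finrank ℚ L)
    [Algebra L ℂ] (hι : (algebraMap L ℂ).comp (cmConjRingHom L) = ι₁) (Φ : CMType (pkgF L))
    (iso : ∀ (F : Summit.HodgeConjecture.CorCM.CMField) (ι : F →+* ℂ) (_ : Summit.HodgeConjecture.CorCM.HermSpace3 F ι)
      (_ : CMType F), ℕ → Prop)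
    (K₁ : C5.SmallLevel (sec42DataOf h iso (pkgF L) ι₁ (pkgV V) Φ).S.K₀) :
    (((componentAlbanesePinTotal hHD hI hU h₃ hA hU7 V h h4 hι Φ iso).Γof K₁).K : Subgroup ↥V.adelicFin) =
      (K₁.1 : Subgroup (sec42DataOf h iso (pkgF L) ι₁ (pkgV V) Φ).G) := by
  have key : ∀ {C' : Sec42Data (honestP5Of h (pkgF L) ι₁ (pkgV V) Φ) (iso (pkgF L) ι₁ (pkgV V) Φ)}
      (e : sec42DataOfFourLe h (pkgV V) Φ h4 (iso (pkgF L) ι₁ (pkgV V) Φ) = C') (K' : C5.SmallLevel C'.S.K₀),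
      ((((componentAlbanesePin hHD hI hU h₃ hA hU7 V h h4 hι Φ (iso (pkgF L) ι₁ (pkgV V) Φ)).transport e).Γof K').K :
        Subgroup ↥V.adelicFin) = (K'.1 : Subgroup C'.G) := by
    intro C' e K'
    subst e
    rfl
  exact key (sec42DataOf_eq_of_four_le h (pkgV V) Φ iso h4).symm K₁

/-- `∃ J, levelLaw J` at the explicit carrier (the shape wb-4's ∕ prove-3's assembly consumes). [cite: Liu2021, §4.2 l. 2062–2074 and Prop. C.5] -/
theorem exists_componentAlbanesePin_levelLaw (hHD : exists_isReal_hodgeModel) (hI : hodgePQ_independent_of_hodgeModel)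
    (hU : BallQuotientUniformisedDatum) (h₃ : CMAbelianVarietyRealised) (hA : Arapura2012_Cor_15_4_6)
    (hU7 : heckeTranslate_definedOver) (V : HodgeCM.HermSpace3 L ι₁) (h : exists_recordSystem) (h4 : 4 ≤ Module.finrank ℚ L)
    [Algebra L ℂ] (hι : (algebraMap L ℂ).comp (cmConjRingHom L) = ι₁) (Φ : CMType (pkgF L)) (iso : ℕ → Prop) :
    ∃ J : ComponentAlbanese hHD hI hU h₃ hA V h Φ (sec42DataOfFourLe h (pkgV V) Φ h4 iso)
        (sec42DataOfFourLe_heckeTranslates hU7 h (pkgV V) Φ h4 iso),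
      ∀ K₁ : C5.SmallLevel (sec42DataOfFourLe h (pkgV V) Φ h4 iso).S.K₀,
        ((J.Γof K₁).K : Subgroup ↥V.adelicFin) = (K₁.1 : Subgroup (sec42DataOfFourLe h (pkgV V) Φ h4 iso).G) :=
  ⟨componentAlbanesePin hHD hI hU h₃ hA hU7 V h h4 hι Φ iso, fun _ => rfl⟩

/-- `∃ J, levelLaw J` at the TOTAL carrier `Model.sec42DataOf ∕ sec42DataOf_heckeTranslates` — the J-socket of the (c)(d) assembly BY VALUE
at the instance `algebraMap L ℂ = ῑ₁`. [cite: Liu2021, §4.2 l. 2053–2074 and Prop. C.5] -/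
theorem exists_componentAlbanesePinTotal_levelLaw (hHD : exists_isReal_hodgeModel) (hI : hodgePQ_independent_of_hodgeModel)
    (hU : BallQuotientUniformisedDatum) (h₃ : CMAbelianVarietyRealised) (hA : Arapura2012_Cor_15_4_6)
    (hU7 : heckeTranslate_definedOver) (V : HodgeCM.HermSpace3 L ι₁) (h : exists_recordSystem) (h4 : 4 ≤ Module.finrank ℚ L)
    [Algebra L ℂ] (hι : (algebraMap L ℂ).comp (cmConjRingHom L) = ι₁) (Φ : CMType (pkgF L))
    (iso : ∀ (F : Summit.HodgeConjecture.CorCM.CMField) (ι : F →+* ℂ) (_ : Summit.HodgeConjecture.CorCM.HermSpace3 F ι)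
      (_ : CMType F), ℕ → Prop) :
    ∃ J : ComponentAlbanese hHD hI hU h₃ hA V h Φ (sec42DataOf h iso (pkgF L) ι₁ (pkgV V) Φ)
        (sec42DataOf_heckeTranslates hU7 h (pkgV V) Φ iso h4),
      ∀ K₁ : C5.SmallLevel (sec42DataOf h iso (pkgF L) ι₁ (pkgV V) Φ).S.K₀,
        ((J.Γof K₁).K : Subgroup ↥V.adelicFin) = (K₁.1 : Subgroup (sec42DataOf h iso (pkgF L) ι₁ (pkgV V) Φ).G) :=
  ⟨componentAlbanesePinTotal hHD hI hU h₃ hA hU7 V h h4 hι Φ iso,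
    componentAlbanesePinTotal_levelLaw hHD hI hU h₃ hA hU7 V h h4 hι Φ iso⟩

end Summit.HodgeConjecture.CorCM.D2Bridge

end
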